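import Literature.LinearAlgebra.NilpotentInvariantSubspaceLatticeIsomorphism
import HarnessLib

/-!
# Lattice isomorphisms between the lattices of PRIMARY transformations (Brickman–Fillmore 1967 Thm. 8, the lattice-intrinsic part;
# Longstaff 1976 steps (ii), (iii), (v)): `φ : L(A) ≅ L(A′)` preserves the length `dim M ∕ deg p`, cyclic members and `Ker p(A)ʲ`

[topic LinearAlgebra]

Topic `Literature/LinearAlgebra` (namespace `Literature.LinearAlgebra`), lane `lit-hodgefound` (Track 2 foundations library; prover seat
`lit-hodgefound-p34`, generation 48, row g48-#10). THEOREMS ONLY (no definition, no instance, no notation, no named fact; net debt `0`). Sequel of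
the seat's `NilpotentInvariantSubspaceLatticeIsomorphism` (the nilpotent case `p = x`: a lattice isomorphism preserves dimension, cyclic
members, `Ker Qʲ`, `Im Qʲ`, and commutes with `M ↦ QM`) and `PrimaryInvariantSubspaceLattice` (Brickman–Fillmore Lemma 4: for `A` `p`-primary,
`p` irreducible of degree `d`, a cover `M ⋖ N` in `L(A)` has `dim N = dim M + d`, `d ∣ dim M`; the socle series `Ker p(A)ʲ` is the least member
of `L(A)` above all members of dimension `≤ jd`; `A|M` is cyclic iff `dim (M ∩ Ker p(A)) ≤ d`). Here `A` is `p`-primary on `V` and `A′` is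
`p′`-primary on `W` (`p`, `p′` irreducible of degrees `d`, `d′` — NOT assumed equal: the two-element chains `L(0 on K¹)` and
`L(companion of an irreducible quadratic)` are isomorphic with `d = 1`, `d′ = 2`), and `φ : L(A) ≅ L(A′)` is any lattice isomorphism.

## Source, VERBATIM
* [BF67] L. Brickman, P. A. Fillmore, *The invariant subspace lattice of a linear transformation*, Canad. J. Math. 19 (1967) 810–822 (held
  text `paper:doi-10-4153-cjm-1967-075-4`): **Theorem 8** (p. 820) «For `i = 1, 2` let `Aᵢ` be a `pᵢ`-primary linear transformation on the
  vector space `Vᵢ` over the field `Fᵢ`. If there is a non-singular semi-linear transformation `(T, σ)` of `V₁` over `F₁` onto `V₂` over `F₂`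
  such that `TA₁ = A₂T`, then `p₁^σ = p₂` and `T` induces an isomorphism of `L(A₁)` onto `L(A₂)`. Conversely, if `L(A₁) ≅ L(A₂)` and if `σ` is
  any isomorphism of `F₁` onto `F₂` with `p₁^σ = p₂`, then there exists a non-singular semi-linear transformation `(T, σ)` such that
  `TA₁ = A₂T`.» Proof: «We suppose then, that `M → M′` is an isomorphism of `L(A₁)` onto `L(A₂)` … By Lemma 2 the interval `[{0}, Wᵢ]` is a
  chain, and hence so is `[{0}, W′ᵢ]`. Therefore `A₂|W′ᵢ` is cyclic.»; **Lemma 4** (p. 813) «Let `A` be `p`-primary … (b) `dim N − dim M =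
  degree of `p`. (c) The degree of `p` divides the dimension of every invariant subspace of `A`.»; **Lemma 2** (p. 812) «`L(A)` is a chain if
  and only if `A` is cyclic and primary».
* [Lo76] W. E. Longstaff, Canad. J. Math. 28 (1976) 1062–1066 (held text `paper:longstaff1976-…`), §3 Thm. 3.1 proof (p. 1063–1064):
  «(ii) Every automorphism of `Lat N` preserves the property of being `N`-cyclic. (iii) Every automorphism of `Lat N` preserves dimension. …
  (v) Each of the subspaces `𝒩(Nʳ)` (`0 ≤ r ≤ k`) is fixed by every automorphism `ν` of `Lat N`.»

## What is formalised (all under `hp : Irreducible p`, `hpm : p.Monic`, `hμ : minpoly k A ∣ p ^ n` and the primed hypotheses for `A′`)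
* §1 `exists_lt_finrank_add_natDegree_eq` (below a non-zero member there is one of dimension `dim M − d`: a co-atom of `L(A|M)` read in `V`).
* §2 ★ **`natDegree_mul_finrank_coe_orderIso`: `d · dim φ(M) = d′ · dim M`** — a lattice isomorphism preserves the LENGTH `dim M ∕ d` of every
  member ([Lo76] (iii) ∕ [BF67] Thm. 8 proof, through Lemma 4 (b)–(c): maximal chains below `M` have `dim M ∕ d` covers on both sides); in
  particular `d · dim W = d′ · dim V`, and `dim φ(M) = dim M` when `d = d′`.
* §3 ★ **`coe_orderIso_ker_aeval_pow`: `φ(Ker p(A)ʲ) = Ker p′(A′)ʲ`** ([Lo76] (v) for isomorphisms of primary lattices: `Ker p(A)ʲ` is the least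
  member above all members of length `≤ j`, a lattice-and-length description), and `φ(M ∩ Ker p(A)ʲ) = φ(M) ∩ Ker p′(A′)ʲ`.
* §4 ★ **`exists_cyclicSubspace_eq_coe_orderIso_of_minpoly_dvd_pow`: `φ` maps cyclic members to cyclic members** ([BF67] Thm. 8 proof ∕ [Lo76]
  (ii); here through the criterion `A|M` cyclic ⟺ `dim (M ∩ Ker p(A)) ≤ d` of `PrimaryInvariantSubspaceLattice` §7 and §2–§3).
* §5 (appended, g48-#11) the chain below a cyclic member (`le_total_of_le_cyclicSubspace_of_minpoly_dvd_pow`, Lemma 2 for `A|Z(x; A)`),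
  `dim Z(p(A)x; A) = dim Z(x; A) − d`, and THE KEY STEP `coe_orderIso_cyclicSubspace_aeval_apply`: `φ(Z(x; A)) = Z(y; A′)` ⟹
  `φ(Z(p(A)x; A)) = Z(p′(A′)y; A′)` (same length inside the chain below `Z(y; A′)`).
* §6 (appended, g48-#11) ★★ **`coe_orderIso_map_aeval`: `φ(p(A)M) = p′(A′)φ(M)`** and `coe_orderIso_comap_aeval`: `φ(p(A)⁻¹M) = p′(A′)⁻¹φ(M)`
  — every lattice isomorphism between primary lattices intertwines Brickman–Fillmore's maps `M ↦ p(A)M`, `M ↦ p(A)⁻¹M` (the lattice shadow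
  of the semi-linear `(T, σ)` of Thm. 8); powers, ★ `coe_orderIso_range_aeval_pow` (`φ(Im p(A)ʲ) = Im p′(A′)ʲ`, [Lo76] (vi)) and
  `coe_orderIso_ker_inf_range_aeval_pow`.
* §7 (appended, g48-#13) [Lo76] step (i) for primary lattices (`supIrred_iff_exists_cyclicSubspace_eq_of_minpoly_dvd_pow`: join-irreducible
  = non-zero cyclic) and the «fixed members»: every automorphism of `L(A)` fixes the spans `Σ_t Ker p(A)^{a_t} ∩ Im p(A)^{b_t}`, and `p(A)M`,
  `p(A)⁻¹M` along with `M`; it preserves dimension.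
* §8 (appended, g48-#14) ★★ **THEOREM 8's COROLLARY for `p`-primary transformations with the SAME `p` (`σ = id`), in full**: a lattice
  isomorphism preserves every nullity `dim Ker f(A)` (`ker_aeval_pow_mul_eq_of_not_dvd`: `Ker (pᵐg)(A) = Ker pᵐ(A)` for `p ∤ g`;
  `finrank_ker_aeval_eq_of_orderIso`), hence the invariant factors (Jacobson's count, the tree's `invariantFactors_eq_of_forall_finrank_ker_aeval_eq`),
  hence ★ `exists_linearEquiv_of_orderIso_of_minpoly_dvd_pow` (an intertwining `T : V ≃ W`), `nonempty_orderIso_iff_exists_linearEquiv_of_minpoly_dvd_pow`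
  and the Corollary verbatim `nonempty_orderIso_iff_exists_conj_of_minpoly_dvd_pow` («`L(A₁) ≅ L(A₂)` iff `A₁` and `A₂` are similar»).
Not formalised: the SEMI-linear `(T, σ)` of Theorem 8 for `p₁ ≠ p₂` (`p₁^σ = p₂`) — TODO(general form): needs the `K = F[x]/(p)`-structure
of [BF67] Thm. 6.

## References
* [BrickmanFillmore1967] L. Brickman, P. A. Fillmore, Canad. J. Math. 19 (1967) 810–822 — Thm. 8 and proof (p. 820), Lemma 2 (p. 812), Lemma 4
  (p. 813).
* [Longstaff1976] W. E. Longstaff, Canad. J. Math. 28 (1976) 1062–1066 — §3 Thm. 3.1 proof, steps (ii), (iii), (v) (pp. 1063–1064).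
* [Jacobson] N. Jacobson, *Lectures in Abstract Algebra II*, Ch. III §10 Thm. 10 (the nullities determine the invariant factors) — through the
  tree's `Literature.LinearAlgebra.InvariantFactorsRecovery`; [AdkinsWeintraub1992] Ch. 5 (same invariant factors ⟹ similar) — through
  `Literature.LinearAlgebra.SimilarityInvariantFactors`.
-/

open Module Polynomial

namespace Literature.LinearAlgebra

variable {k : Type*} [Field k]
variable {V : Type*} [AddCommGroup V] [Module k V] [FiniteDimensional k V]
variable {W : Type*} [AddCommGroup W] [Module k W] [FiniteDimensional k W]
variable {A : Module.End k V} {A' : Module.End k W} {p p' : k[X]} {n n' : ℕ}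

/-! ## §1 Below a non-zero member of `L(A)` there is a member of dimension `dim M − d` -/

omit [FiniteDimensional k W] in
/-- For `A` `p`-primary (`p` irreducible of degree `d`) and a non-zero `M ∈ L(A)` there is `M₀ ∈ L(A)`, `M₀ < M`, `dim M₀ + d = dim M` (a co-atom
of the lattice `L(A|M)`, whose members have dimensions exactly the multiples of `d` up to `dim M`, read in `V`).
[cite: BrickmanFillmore1967, Lemma 4 (b), (c) (p. 813)] -/
theorem exists_lt_finrank_add_natDegree_eq (hp : Irreducible p) (hpm : p.Monic) (hμ : minpoly k A ∣ p ^ n) {M : Submodule k V}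
    (hM : M ∈ A.invtSubmodule) (hM0 : M ≠ ⊥) :
    ∃ M₀ ∈ A.invtSubmodule, M₀ < M ∧ finrank k M₀ + p.natDegree = finrank k M := by
  have hM' := (Module.End.mem_invtSubmodule_iff_forall_mem_of_mem A).1 hM
  have hd : 0 < p.natDegree := Polynomial.natDegree_pos_iff_degree_pos.2 (degree_pos_of_irreducible hp)
  have hdvd : p.natDegree ∣ finrank k M := natDegree_dvd_finrank_of_mem_invtSubmodule A hp hpm hμ hM
  have hpos : 0 < finrank k M := by
    rw [Nat.pos_iff_ne_zero, Ne, Submodule.finrank_eq_zero]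
    exact hM0
  have hle : p.natDegree ≤ finrank k M := Nat.le_of_dvd hpos hdvd
  obtain ⟨s, -, hs, -⟩ := exists_minpoly_restrict_eq_pow A hp hpm hμ hM'
  have hμ' : minpoly k (A.restrict hM') ∣ p ^ s := hs ▸ dvd_rfl
  obtain ⟨N, hN, hNj⟩ := (exists_mem_invtSubmodule_finrank_eq_iff (A.restrict hM') hp hpm hμ'
    (r := finrank k M - p.natDegree)).2 ⟨Nat.dvd_sub hdvd (dvd_refl _), by rw [finrank]; omega⟩
  refine ⟨N.map M.subtype, (map_subtype_mem_invtSubmodule_iff A hM').2 hN, ?_, ?_⟩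
  · refine Submodule.lt_of_le_of_finrank_lt_finrank (Submodule.map_subtype_le M N) ?_
    rw [Submodule.finrank_map_subtype_eq, hNj]
    omega
  · rw [Submodule.finrank_map_subtype_eq, hNj]
    omega

/-! ## §2 A lattice isomorphism preserves the length `dim M ∕ d` -/

/-- **`d · dim φ(M) = d′ · dim M` for every `M ∈ L(A)`** (`A` `p`-primary on `V`, `A′` `p′`-primary on `W`, `d = deg p`, `d′ = deg p′`,
`φ : L(A) ≅ L(A′)` a lattice isomorphism): climb a maximal chain below `M` — it has `dim M ∕ d` covers, each raising the dimension by `d` in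
`L(A)` and by `d′` in `L(A′)` (Lemma 4 (b), (c); «every automorphism of `Lat N` preserves dimension»).
[cite: BrickmanFillmore1967, Lemma 4 (b), (c) (p. 813), Thm. 8 proof (p. 820)] [cite: Longstaff1976, §3 Thm. 3.1 proof (iii) (p. 1063)] -/
theorem natDegree_mul_finrank_coe_orderIso (hp : Irreducible p) (hpm : p.Monic) (hμ : minpoly k A ∣ p ^ n)
    (hp' : Irreducible p') (hpm' : p'.Monic) (hμ' : minpoly k A' ∣ p' ^ n') (φ : A.invtSubmodule ≃o A'.invtSubmodule)
    (M : A.invtSubmodule) : p.natDegree * finrank k (φ M : Submodule k W) = p'.natDegree * finrank k (M : Submodule k V) := by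
  suffices h : ∀ m : ℕ, ∀ M : A.invtSubmodule, finrank k (M : Submodule k V) = m →
      p.natDegree * finrank k (φ M : Submodule k W) = p'.natDegree * m from h _ M rfl
  intro m
  induction m using Nat.strong_induction_on with
  | _ m ih =>
    intro M hM
    by_cases hM0 : (M : Submodule k V) = ⊥
    · have hM' : M = ⟨⊥, Module.End.invtSubmodule.bot_mem A⟩ := Subtype.ext hM0
      rw [← hM, hM', coe_orderIso_bot φ, finrank_bot, mul_zero]
      change 0 = p'.natDegree * finrank k (⊥ : Submodule k V)
      rw [finrank_bot, mul_zero]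
    obtain ⟨M₀, hM₀, hlt, hdim⟩ := exists_lt_finrank_add_natDegree_eq hp hpm hμ M.2 hM0
    have hd : 0 < p.natDegree := Polynomial.natDegree_pos_iff_degree_pos.2 (degree_pos_of_irreducible hp)
    have ih₀ := ih (finrank k M₀) (by omega) ⟨M₀, hM₀⟩ rfl
    -- `M₀ ⋖ M` in `L(A)`: a member strictly between would have a dimension strictly between two consecutive multiples of `d`
    have hcov : ∀ P ∈ A.invtSubmodule, ((⟨M₀, hM₀⟩ : A.invtSubmodule) : Submodule k V) ≤ P → P ≤ M →
        P = (⟨M₀, hM₀⟩ : A.invtSubmodule) ∨ P = M := by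
      intro P hP hMP hPM
      rcases hMP.eq_or_lt with h1 | h1
      · exact Or.inl h1.symm
      rcases hPM.eq_or_lt with h2 | h2
      · exact Or.inr h2
      exfalso
      have h1' := Submodule.finrank_lt_finrank_of_lt h1
      have h2' := Submodule.finrank_lt_finrank_of_lt h2
      change finrank k M₀ < finrank k P at h1'
      obtain ⟨a, ha⟩ := natDegree_dvd_finrank_of_mem_invtSubmodule A hp hpm hμ hM₀
      obtain ⟨b, hb⟩ := natDegree_dvd_finrank_of_mem_invtSubmodule A hp hpm hμ hP
      rw [ha] at h1' hdim
      rw [hb] at h1' h2'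
      rw [← hdim, ← mul_add_one] at h2'
      have h3 := Nat.lt_of_mul_lt_mul_left h1'
      have h4 := Nat.lt_of_mul_lt_mul_left h2'
      omega
    obtain ⟨hlt', hcov'⟩ := orderIso_covBy' φ (M := ⟨M₀, hM₀⟩) hlt hcov
    rw [finrank_eq_add_natDegree_of_covBy' A' hp' hpm' hμ' (φ ⟨M₀, hM₀⟩).2 (φ M).2 hlt' hcov', ← hM, ← hdim, mul_add, ih₀, mul_add,
      mul_comm p.natDegree p'.natDegree]

/-- In particular `d · dim W = d′ · dim V`. [cite: BrickmanFillmore1967, Thm. 8 (p. 820)] -/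
theorem natDegree_mul_finrank_eq_of_orderIso (hp : Irreducible p) (hpm : p.Monic) (hμ : minpoly k A ∣ p ^ n)
    (hp' : Irreducible p') (hpm' : p'.Monic) (hμ' : minpoly k A' ∣ p' ^ n') (φ : A.invtSubmodule ≃o A'.invtSubmodule) :
    p.natDegree * finrank k W = p'.natDegree * finrank k V := by
  rw [← finrank_top k V, ← finrank_top k W, ← coe_orderIso_top φ]
  exact natDegree_mul_finrank_coe_orderIso hp hpm hμ hp' hpm' hμ' φ _

/-- When `deg p = deg p′` (e.g. `p = p′`, the setting of Brickman–Fillmore's Corollary) the isomorphism preserves dimension: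
`dim φ(M) = dim M`. [cite: BrickmanFillmore1967, Thm. 8 and Corollary (p. 820)] [cite: Longstaff1976, §3 Thm. 3.1 proof (iii) (p. 1063)] -/
theorem finrank_coe_orderIso_of_natDegree_eq (hp : Irreducible p) (hpm : p.Monic) (hμ : minpoly k A ∣ p ^ n)
    (hp' : Irreducible p') (hpm' : p'.Monic) (hμ' : minpoly k A' ∣ p' ^ n') (hd : p.natDegree = p'.natDegree)
    (φ : A.invtSubmodule ≃o A'.invtSubmodule) (M : A.invtSubmodule) :
    finrank k (φ M : Submodule k W) = finrank k (M : Submodule k V) := by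
  have h := natDegree_mul_finrank_coe_orderIso hp hpm hμ hp' hpm' hμ' φ M
  have hd0 : 0 < p'.natDegree := Polynomial.natDegree_pos_iff_degree_pos.2 (degree_pos_of_irreducible hp')
  rw [hd] at h
  exact Nat.eq_of_mul_eq_mul_left hd0 h

/-- The length comparison as an equivalence of bounds: `dim φ(M) ≤ j·d′ ⟺ dim M ≤ j·d`.
[cite: BrickmanFillmore1967, Lemma 4 (c) (p. 813), Thm. 8 proof (p. 820)] -/
theorem finrank_coe_orderIso_le_iff (hp : Irreducible p) (hpm : p.Monic) (hμ : minpoly k A ∣ p ^ n)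
    (hp' : Irreducible p') (hpm' : p'.Monic) (hμ' : minpoly k A' ∣ p' ^ n') (φ : A.invtSubmodule ≃o A'.invtSubmodule)
    (M : A.invtSubmodule) (j : ℕ) :
    finrank k (φ M : Submodule k W) ≤ j * p'.natDegree ↔ finrank k (M : Submodule k V) ≤ j * p.natDegree := by
  have h := natDegree_mul_finrank_coe_orderIso hp hpm hμ hp' hpm' hμ' φ M
  have hd : 0 < p.natDegree := Polynomial.natDegree_pos_iff_degree_pos.2 (degree_pos_of_irreducible hp)
  have hd' : 0 < p'.natDegree := Polynomial.natDegree_pos_iff_degree_pos.2 (degree_pos_of_irreducible hp')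
  constructor
  · intro hle
    have h1 : p'.natDegree * finrank k (M : Submodule k V) ≤ p'.natDegree * (j * p.natDegree) :=
      calc p'.natDegree * finrank k (M : Submodule k V) = p.natDegree * finrank k (φ M : Submodule k W) := h.symm
        _ ≤ p.natDegree * (j * p'.natDegree) := Nat.mul_le_mul_left _ hle
        _ = p'.natDegree * (j * p.natDegree) := by ring
    exact Nat.le_of_mul_le_mul_left h1 hd'
  · intro hle
    have h1 : p.natDegree * finrank k (φ M : Submodule k W) ≤ p.natDegree * (j * p'.natDegree) :=
      calc p.natDegree * finrank k (φ M : Submodule k W) = p'.natDegree * finrank k (M : Submodule k V) := h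
        _ ≤ p'.natDegree * (j * p.natDegree) := Nat.mul_le_mul_left _ hle
        _ = p.natDegree * (j * p'.natDegree) := by ring
    exact Nat.le_of_mul_le_mul_left h1 hd

/-! ## §3 `φ(Ker p(A)ʲ) = Ker p′(A′)ʲ` -/

/-- **`φ(Ker p(A)ʲ) = Ker p′(A′)ʲ`**: both are the least members of their lattices lying above every member of length `≤ j`
(`PrimaryInvariantSubspaceLattice.isLeast_ker_aeval_pow`), and `φ` matches members of length `≤ j` (§2).
[cite: Longstaff1976, §3 Thm. 3.1 proof (v) (p. 1064)] [cite: BrickmanFillmore1967, Thm. 9 proof (p. 821: «the interval [{0}, ker p₁(A₁)] … its image [{0}, N] … p₂ is the minimum polynomial of A₂|N»)] -/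
theorem coe_orderIso_ker_aeval_pow (hp : Irreducible p) (hpm : p.Monic) (hμ : minpoly k A ∣ p ^ n)
    (hp' : Irreducible p') (hpm' : p'.Monic) (hμ' : minpoly k A' ∣ p' ^ n') (φ : A.invtSubmodule ≃o A'.invtSubmodule) (j : ℕ)
    (N : A.invtSubmodule) (hN : (N : Submodule k V) = LinearMap.ker (aeval A (p ^ j))) :
    (φ N : Submodule k W) = LinearMap.ker (aeval A' (p' ^ j)) := by
  have h1 := isLeast_ker_aeval_pow A hp hpm hμ j
  have h2 := isLeast_ker_aeval_pow A' hp' hpm' hμ' j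
  rw [← hN] at h1
  have hφN : IsLeast {N' : Submodule k W | N' ∈ A'.invtSubmodule ∧
      ∀ M' ∈ A'.invtSubmodule, finrank k M' ≤ j * p'.natDegree → M' ≤ N'} (φ N : Submodule k W) := by
    refine ⟨⟨(φ N).2, fun M' hM' hM'j ↦ ?_⟩, fun N' hN' ↦ ?_⟩
    · -- members of length `≤ j` of `L(A′)` come from members of length `≤ j` of `L(A)`
      have hle : φ.symm ⟨M', hM'⟩ ≤ N := by
        refine h1.1.2 _ (φ.symm ⟨M', hM'⟩).2 ?_
        rw [← finrank_coe_orderIso_le_iff hp hpm hμ hp' hpm' hμ' φ _ j, φ.apply_symm_apply]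
        exact hM'j
      have := φ.monotone hle
      rwa [φ.apply_symm_apply] at this
    · -- `φ⁻¹N′` lies above every member of length `≤ j`, hence above `Ker p(A)ʲ = N`
      obtain ⟨hN'mem, hN'ub⟩ := hN'
      have hle : N ≤ φ.symm ⟨N', hN'mem⟩ := by
        refine h1.2 ⟨(φ.symm ⟨N', hN'mem⟩).2, fun M hM hMj ↦ ?_⟩
        have h3 : φ ⟨M, hM⟩ ≤ ⟨N', hN'mem⟩ :=
          show (φ ⟨M, hM⟩ : Submodule k W) ≤ N' from
            hN'ub _ (φ ⟨M, hM⟩).2 ((finrank_coe_orderIso_le_iff hp hpm hμ hp' hpm' hμ' φ ⟨M, hM⟩ j).2 hMj)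
        exact φ.le_symm_apply.2 h3
      have := φ.monotone hle
      rwa [φ.apply_symm_apply] at this
  exact hφN.unique h2

/-- Hence `φ(M ∩ Ker p(A)ʲ) = φ(M) ∩ Ker p′(A′)ʲ` for every member `M`. [cite: Longstaff1976, §3 Thm. 3.1 proof (v), (vii) (pp. 1064–1065)] -/
theorem coe_orderIso_inf_ker_aeval_pow (hp : Irreducible p) (hpm : p.Monic) (hμ : minpoly k A ∣ p ^ n)
    (hp' : Irreducible p') (hpm' : p'.Monic) (hμ' : minpoly k A' ∣ p' ^ n') (φ : A.invtSubmodule ≃o A'.invtSubmodule) (j : ℕ)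
    (M N : A.invtSubmodule) (hN : (N : Submodule k V) = (M : Submodule k V) ⊓ LinearMap.ker (aeval A (p ^ j))) :
    (φ N : Submodule k W) = (φ M : Submodule k W) ⊓ LinearMap.ker (aeval A' (p' ^ j)) := by
  have hN' : N = M ⊓ ⟨LinearMap.ker (aeval A (p ^ j)), ker_aeval_mem_invtSubmodule A _⟩ :=
    Subtype.ext (by rw [Sublattice.coe_inf]; exact hN)
  rw [hN', coe_orderIso_inf φ, coe_orderIso_ker_aeval_pow hp hpm hμ hp' hpm' hμ' φ j
    ⟨LinearMap.ker (aeval A (p ^ j)), ker_aeval_mem_invtSubmodule A _⟩ rfl]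

/-! ## §4 `φ` maps cyclic members to cyclic members -/

omit [FiniteDimensional k W] in
/-- `A|M` is cyclic iff `dim (M ∩ Ker p(A)) ≤ d` (`A` `p`-primary; the criterion `dim Ker p(A|M) ≤ d` of `PrimaryInvariantSubspaceLattice` read
in `V`). [cite: BrickmanFillmore1967, Lemma 2 (p. 812), Thm. 4 Cor. 2 proof (p. 816)] -/
theorem exists_cyclicSubspace_eq_iff_finrank_inf_ker_aeval_le (hp : Irreducible p) (hpm : p.Monic) (hμ : minpoly k A ∣ p ^ n)
    {M : Submodule k V} (hM : M ∈ A.invtSubmodule) :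
    (∃ v : V, cyclicSubspace A v = M) ↔ finrank k ↥(M ⊓ LinearMap.ker (aeval A p)) ≤ p.natDegree := by
  have hM' := (Module.End.mem_invtSubmodule_iff_forall_mem_of_mem A).1 hM
  obtain ⟨s, -, hs, -⟩ := exists_minpoly_restrict_eq_pow A hp hpm hμ hM'
  have hμM : minpoly k (A.restrict hM') ∣ p ^ s := hs ▸ dvd_rfl
  rw [← exists_cyclicSubspace_restrict_eq_top_iff A hM',
    cyclic_iff_finrank_ker_aeval_le_natDegree_of_minpoly_dvd_pow (A.restrict hM') hp hpm hμM]
  -- `Ker p(A|M)` read in `V` is `M ∩ Ker p(A)`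
  have hker : (LinearMap.ker (aeval (A.restrict hM') p)).map M.subtype = M ⊓ LinearMap.ker (aeval A p) := by
    ext x
    simp only [Submodule.mem_map, LinearMap.mem_ker, Submodule.mem_inf, Submodule.coe_subtype]
    constructor
    · rintro ⟨y, hy, rfl⟩
      refine ⟨y.2, ?_⟩
      rw [← aeval_restrict_apply A hM' p y, hy, ZeroMemClass.coe_zero]
    · rintro ⟨hx, hx0⟩
      refine ⟨⟨x, hx⟩, Subtype.ext ?_, rfl⟩
      rw [aeval_restrict_apply A hM' p ⟨x, hx⟩, ZeroMemClass.coe_zero]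
      exact hx0
  rw [← hker, Submodule.finrank_map_subtype_eq]

/-- **`φ` maps cyclic members of `L(A)` to cyclic members of `L(A′)`** («By Lemma 2 the interval `[{0}, Wᵢ]` is a chain, and hence so is
`[{0}, W′ᵢ]`. Therefore `A₂|W′ᵢ` is cyclic»; here: `A|M` cyclic ⟺ `dim (M ∩ Ker p(A)) ≤ d` ⟺ length `≤ 1`, matched by `φ` through §2–§3).
[cite: BrickmanFillmore1967, Thm. 8 proof (p. 820), Lemma 2 (p. 812)] [cite: Longstaff1976, §3 Thm. 3.1 proof (ii) (p. 1063)] -/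
theorem exists_cyclicSubspace_eq_coe_orderIso_of_minpoly_dvd_pow (hp : Irreducible p) (hpm : p.Monic) (hμ : minpoly k A ∣ p ^ n)
    (hp' : Irreducible p') (hpm' : p'.Monic) (hμ' : minpoly k A' ∣ p' ^ n') (φ : A.invtSubmodule ≃o A'.invtSubmodule)
    (M : A.invtSubmodule) (hM : ∃ v : V, cyclicSubspace A v = M) : ∃ w : W, cyclicSubspace A' w = φ M := by
  rw [exists_cyclicSubspace_eq_iff_finrank_inf_ker_aeval_le hp' hpm' hμ' (φ M).2]
  rw [exists_cyclicSubspace_eq_iff_finrank_inf_ker_aeval_le hp hpm hμ M.2] at hM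
  obtain ⟨N, hN⟩ : ∃ N : A.invtSubmodule, (N : Submodule k V) = (M : Submodule k V) ⊓ LinearMap.ker (aeval A (p ^ 1)) :=
    ⟨M ⊓ ⟨LinearMap.ker (aeval A (p ^ 1)), ker_aeval_mem_invtSubmodule A _⟩, by rw [Sublattice.coe_inf]⟩
  have h1 := coe_orderIso_inf_ker_aeval_pow hp hpm hμ hp' hpm' hμ' φ 1 M N hN
  rw [pow_one] at hN h1
  rw [← h1, ← one_mul p'.natDegree, finrank_coe_orderIso_le_iff hp hpm hμ hp' hpm' hμ' φ N 1, hN, one_mul]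
  exact hM

/-- **Cyclic members correspond under `φ` (both directions).** [cite: BrickmanFillmore1967, Thm. 8 proof (p. 820)] -/
theorem exists_cyclicSubspace_eq_coe_orderIso_iff (hp : Irreducible p) (hpm : p.Monic) (hμ : minpoly k A ∣ p ^ n)
    (hp' : Irreducible p') (hpm' : p'.Monic) (hμ' : minpoly k A' ∣ p' ^ n') (φ : A.invtSubmodule ≃o A'.invtSubmodule)
    (M : A.invtSubmodule) : (∃ w : W, cyclicSubspace A' w = φ M) ↔ ∃ v : V, cyclicSubspace A v = M := by
  refine ⟨fun h ↦ ?_, exists_cyclicSubspace_eq_coe_orderIso_of_minpoly_dvd_pow hp hpm hμ hp' hpm' hμ' φ M⟩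
  have := exists_cyclicSubspace_eq_coe_orderIso_of_minpoly_dvd_pow hp' hpm' hμ' hp hpm hμ φ.symm (φ M) h
  rwa [φ.symm_apply_apply] at this

/-! ## §5 The chain below a cyclic member; `φ(Z(p(A)x; A)) = Z(p′(A′)y; A′)` -/

omit [FiniteDimensional k V] [FiniteDimensional k W] in
/-- `Z(q(A)v; A) ⊆ Z(v; A)` (and `q(A)Z(v; A) = Z(q(A)v; A)` is the tree's `map_aeval_cyclicSubspace`). [cite: BrickmanFillmore1967, §1 (p. 811)] -/
theorem cyclicSubspace_aeval_apply_le (A : Module.End k V) (q : k[X]) (v : V) :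
    cyclicSubspace A (aeval A q v) ≤ cyclicSubspace A v :=
  (cyclicSubspace_le_iff A _ (cyclicSubspace_mem_invtSubmodule A v)).2 (aeval_apply_self_mem_cyclicSubspace A v q)

omit [FiniteDimensional k W] in
/-- **Lemma 2 below a cyclic member: for `A` `p`-primary the members of `L(A)` inside `Z(x; A)` form a chain** (`A|Z(x; A)` is cyclic and
primary). [cite: BrickmanFillmore1967, Lemma 2 (p. 812), Thm. 8 proof (p. 820)] -/
theorem le_total_of_le_cyclicSubspace_of_minpoly_dvd_pow (hp : Irreducible p) (hpm : p.Monic) (hμ : minpoly k A ∣ p ^ n) (x : V)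
    {M N : Submodule k V} (hM : M ∈ A.invtSubmodule) (hN : N ∈ A.invtSubmodule) (hMx : M ≤ cyclicSubspace A x)
    (hNx : N ≤ cyclicSubspace A x) : M ≤ N ∨ N ≤ M := by
  have hZ' := apply_mem_cyclicSubspace A x
  obtain ⟨s, -, hs, -⟩ := exists_minpoly_restrict_eq_pow A hp hpm hμ hZ'
  have htop : LinearMap.ker (aeval (A.restrict hZ') (p ^ s)) = ⊤ := by
    rw [← hs, minpoly.aeval, LinearMap.ker_zero]
  have hv := cyclicSubspace_restrict_self_eq_top A x
  have hM' := comap_subtype_mem_invtSubmodule_restrict A hZ' hM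
  have hN' := comap_subtype_mem_invtSubmodule_restrict A hZ' hN
  have key : ∀ {M N : Submodule k V}, M ≤ cyclicSubspace A x → N ≤ cyclicSubspace A x →
      M.comap (cyclicSubspace A x).subtype ≤ N.comap (cyclicSubspace A x).subtype → M ≤ N := by
    intro M N hMx hNx h
    have h2 := Submodule.map_mono (f := (cyclicSubspace A x).subtype) h
    rwa [Submodule.map_comap_subtype, Submodule.map_comap_subtype, inf_eq_right.2 hMx, inf_eq_right.2 hNx] at h2
  rcases le_total_of_cyclic_of_le_ker_aeval_pow (A.restrict hZ') hv hp hpm hM' hN' (htop ▸ le_top) (htop ▸ le_top) with h | h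
  · exact Or.inl (key hMx hNx h)
  · exact Or.inr (key hNx hMx h)

omit [FiniteDimensional k W] in
/-- For `A` `p`-primary, `dim Z(p(A)x; A) = dim Z(x; A) − d`. [cite: BrickmanFillmore1967, Lemma 4 (b) proof (p. 814: «`dim Z(x) − dim Z(p(A)x) = degree of p`»)] -/
theorem finrank_cyclicSubspace_aeval_apply (hp : Irreducible p) (hpm : p.Monic) (hμ : minpoly k A ∣ p ^ n) (x : V) :
    finrank k ↥(cyclicSubspace A (aeval A p x)) = finrank k ↥(cyclicSubspace A x) - p.natDegree := by
  obtain ⟨j, -, hj⟩ := exists_annihilatorPoly_eq_pow A hp hpm hμ x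
  rcases j with _ | j
  · rw [pow_zero, annihilatorPoly_eq_one_iff] at hj
    rw [hj, map_zero]
    have h0 : cyclicSubspace A (0 : V) = ⊥ :=
      le_bot_iff.1 ((cyclicSubspace_le_iff A (0 : V) (Module.End.invtSubmodule.bot_mem A)).2 (Submodule.zero_mem _))
    rw [h0, finrank_bot, Nat.zero_sub]
  · rw [finrank_cyclicSubspace_eq_add_of_annihilatorPoly_eq_pow_succ A hpm hj, Nat.add_sub_cancel]

/-- THE KEY STEP for primary lattices: if `φ(Z(x; A)) = Z(y; A′)` then `φ(Z(p(A)x; A)) = Z(p′(A′)y; A′)` — both sides are members of the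
chain below `Z(y; A′)` of the same length `ℓ(Z(x; A)) − 1`. [cite: BrickmanFillmore1967, Thm. 8 proof (p. 820), Lemma 2 (p. 812), Lemma 4 (b) (p. 813)]
[cite: Longstaff1976, §3 Thm. 3.1 proof (ii)–(iv) (pp. 1063–1064)] -/
theorem coe_orderIso_cyclicSubspace_aeval_apply (hp : Irreducible p) (hpm : p.Monic) (hμ : minpoly k A ∣ p ^ n)
    (hp' : Irreducible p') (hpm' : p'.Monic) (hμ' : minpoly k A' ∣ p' ^ n') (φ : A.invtSubmodule ≃o A'.invtSubmodule)
    {x : V} {y : W} {Z Z₁ : A.invtSubmodule} (hZ : (Z : Submodule k V) = cyclicSubspace A x)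
    (hZ₁ : (Z₁ : Submodule k V) = cyclicSubspace A (aeval A p x)) (h : (φ Z : Submodule k W) = cyclicSubspace A' y) :
    (φ Z₁ : Submodule k W) = cyclicSubspace A' (aeval A' p' y) := by
  have hd : 0 < p.natDegree := Polynomial.natDegree_pos_iff_degree_pos.2 (degree_pos_of_irreducible hp)
  have hd' : 0 < p'.natDegree := Polynomial.natDegree_pos_iff_degree_pos.2 (degree_pos_of_irreducible hp')
  -- the common length `ℓ`
  obtain ⟨ℓ, hℓ⟩ := natDegree_dvd_finrank_of_mem_invtSubmodule A hp hpm hμ Z.2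
  have hb : finrank k ↥(cyclicSubspace A' y) = p'.natDegree * ℓ := by
    have h1 := natDegree_mul_finrank_coe_orderIso hp hpm hμ hp' hpm' hμ' φ Z
    rw [h, hℓ, mul_left_comm] at h1
    exact Nat.eq_of_mul_eq_mul_left hd h1
  have ha₁ : finrank k (Z₁ : Submodule k V) = p.natDegree * (ℓ - 1) := by
    rw [hZ₁, finrank_cyclicSubspace_aeval_apply hp hpm hμ x, ← hZ, hℓ, Nat.mul_sub_one]
  have hb₁ : finrank k ↥(cyclicSubspace A' (aeval A' p' y)) = p'.natDegree * (ℓ - 1) := by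
    rw [finrank_cyclicSubspace_aeval_apply hp' hpm' hμ' y, hb, Nat.mul_sub_one]
  have hφ₁ : finrank k (φ Z₁ : Submodule k W) = p'.natDegree * (ℓ - 1) := by
    have h1 := natDegree_mul_finrank_coe_orderIso hp hpm hμ hp' hpm' hμ' φ Z₁
    rw [ha₁, mul_left_comm] at h1
    exact Nat.eq_of_mul_eq_mul_left hd h1
  have hle : Z₁ ≤ Z := show (Z₁ : Submodule k V) ≤ Z by rw [hZ, hZ₁]; exact cyclicSubspace_aeval_apply_le A p x
  have hAle : (φ Z₁ : Submodule k W) ≤ cyclicSubspace A' y :=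
    calc (φ Z₁ : Submodule k W) ≤ φ Z := φ.monotone hle
      _ = cyclicSubspace A' y := h
  rcases le_total_of_le_cyclicSubspace_of_minpoly_dvd_pow hp' hpm' hμ' y (φ Z₁).2
      (cyclicSubspace_mem_invtSubmodule A' _) hAle (cyclicSubspace_aeval_apply_le A' p' y) with hle' | hle'
  · exact Submodule.eq_of_le_of_finrank_eq hle' (by rw [hφ₁, hb₁])
  · exact (Submodule.eq_of_le_of_finrank_eq hle' (by rw [hφ₁, hb₁])).symm

/-! ## §6 The isomorphism commutes with `M ↦ p(A)M`, `M ↦ p(A)⁻¹M`; `φ(Im p(A)ʲ) = Im p′(A′)ʲ` -/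

/-- One half: `p′(A′)φ(M) ⊆ φ(p(A)M)`. [cite: BrickmanFillmore1967, Thm. 8 proof (p. 820)] [cite: Longstaff1976, §3 Thm. 3.1 proof (v)–(vi) (p. 1064)] -/
theorem map_aeval_coe_orderIso_le (hp : Irreducible p) (hpm : p.Monic) (hμ : minpoly k A ∣ p ^ n)
    (hp' : Irreducible p') (hpm' : p'.Monic) (hμ' : minpoly k A' ∣ p' ^ n') (φ : A.invtSubmodule ≃o A'.invtSubmodule)
    (M N : A.invtSubmodule) (hN : (N : Submodule k V) = (M : Submodule k V).map (aeval A p)) :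
    (φ M : Submodule k W).map (aeval A' p') ≤ φ N := by
  rw [Submodule.map_le_iff_le_comap]
  intro y hy
  rw [Submodule.mem_comap]
  obtain ⟨Zy, hZy⟩ : ∃ Zy : A'.invtSubmodule, (Zy : Submodule k W) = cyclicSubspace A' y :=
    ⟨⟨_, cyclicSubspace_mem_invtSubmodule A' y⟩, rfl⟩
  have hZy_le : Zy ≤ φ M := show (Zy : Submodule k W) ≤ φ M by rw [hZy]; exact (cyclicSubspace_le_iff A' y (φ M).2).2 hy
  obtain ⟨x, hx⟩ := (exists_cyclicSubspace_eq_coe_orderIso_iff hp hpm hμ hp' hpm' hμ' φ (φ.symm Zy)).1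
    ⟨y, by rw [φ.apply_symm_apply, hZy]⟩
  have hφZ : ((φ (φ.symm Zy) : A'.invtSubmodule) : Submodule k W) = cyclicSubspace A' y := by
    rw [φ.apply_symm_apply, hZy]
  have hxM : cyclicSubspace A x ≤ (M : Submodule k V) :=
    calc cyclicSubspace A x = ((φ.symm Zy : A.invtSubmodule) : Submodule k V) := hx
      _ ≤ ((φ.symm (φ M) : A.invtSubmodule) : Submodule k V) := φ.symm.monotone hZy_le
      _ = M := by rw [φ.symm_apply_apply]
  obtain ⟨Z₁, hZ₁⟩ : ∃ Z₁ : A.invtSubmodule, (Z₁ : Submodule k V) = cyclicSubspace A (aeval A p x) :=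
    ⟨⟨_, cyclicSubspace_mem_invtSubmodule A _⟩, rfl⟩
  have key := coe_orderIso_cyclicSubspace_aeval_apply hp hpm hμ hp' hpm' hμ' φ hx.symm hZ₁ hφZ
  have hle : Z₁ ≤ N := show (Z₁ : Submodule k V) ≤ N by
    rw [hN, hZ₁, ← map_aeval_cyclicSubspace]
    exact Submodule.map_mono hxM
  have hle' : cyclicSubspace A' (aeval A' p' y) ≤ (φ N : Submodule k W) :=
    calc cyclicSubspace A' (aeval A' p' y) = (φ Z₁ : Submodule k W) := key.symm
      _ ≤ φ N := φ.monotone hle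
  exact hle' (self_mem_cyclicSubspace A' _)

/-- **A lattice isomorphism between primary lattices intertwines `M ↦ p(A)M` with `M′ ↦ p′(A′)M′`: `φ(p(A)M) = p′(A′)φ(M)`** — the
lattice-intrinsic shadow of Brickman–Fillmore's semi-linear `(T, σ)` with `TA₁ = A₂T`, `p₁^σ = p₂` (the isomorphism of their Theorem 8 is
only assumed, not constructed). [cite: BrickmanFillmore1967, Thm. 8 (p. 820), §5 Remark (p. 821)] [cite: Longstaff1976, §3 Thm. 3.1 proof (v)–(vi) (p. 1064)] -/
theorem coe_orderIso_map_aeval (hp : Irreducible p) (hpm : p.Monic) (hμ : minpoly k A ∣ p ^ n)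
    (hp' : Irreducible p') (hpm' : p'.Monic) (hμ' : minpoly k A' ∣ p' ^ n') (φ : A.invtSubmodule ≃o A'.invtSubmodule)
    (M N : A.invtSubmodule) (hN : (N : Submodule k V) = (M : Submodule k V).map (aeval A p)) :
    (φ N : Submodule k W) = (φ M : Submodule k W).map (aeval A' p') := by
  refine le_antisymm ?_ (map_aeval_coe_orderIso_le hp hpm hμ hp' hpm' hμ' φ M N hN)
  obtain ⟨N', hN'⟩ : ∃ N' : A'.invtSubmodule, (N' : Submodule k W) = (φ M : Submodule k W).map (aeval A' p') :=
    ⟨⟨_, map_aeval_mem_invtSubmodule A' (φ M).2 p'⟩, rfl⟩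
  have h1 := map_aeval_coe_orderIso_le hp' hpm' hμ' hp hpm hμ φ.symm (φ M) N' hN'
  rw [φ.symm_apply_apply] at h1
  have h2 : N ≤ φ.symm N' := show (N : Submodule k V) ≤ φ.symm N' by rw [hN]; exact h1
  have h3 := φ.monotone h2
  rw [φ.apply_symm_apply] at h3
  calc (φ N : Submodule k W) ≤ N' := h3
    _ = _ := hN'

/-- Powers: `φ(p(A)ʲM) = p′(A′)ʲφ(M)`. [cite: BrickmanFillmore1967, Thm. 8 (p. 820)] -/
theorem coe_orderIso_map_aeval_pow (hp : Irreducible p) (hpm : p.Monic) (hμ : minpoly k A ∣ p ^ n)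
    (hp' : Irreducible p') (hpm' : p'.Monic) (hμ' : minpoly k A' ∣ p' ^ n') (φ : A.invtSubmodule ≃o A'.invtSubmodule) (j : ℕ)
    (M N : A.invtSubmodule) (hN : (N : Submodule k V) = (M : Submodule k V).map (aeval A (p ^ j))) :
    (φ N : Submodule k W) = (φ M : Submodule k W).map (aeval A' (p' ^ j)) := by
  induction j generalizing N with
  | zero =>
    rw [pow_zero, map_one, Module.End.one_eq_id, Submodule.map_id] at hN ⊢
    rw [show N = M from Subtype.ext hN]
  | succ j ih =>
    obtain ⟨P, hP⟩ : ∃ P : A.invtSubmodule, (P : Submodule k V) = (M : Submodule k V).map (aeval A (p ^ j)) :=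
      ⟨⟨_, map_aeval_mem_invtSubmodule A M.2 _⟩, rfl⟩
    have hN' : (N : Submodule k V) = (P : Submodule k V).map (aeval A p) := by
      rw [hN, hP, pow_succ', map_mul, Module.End.mul_eq_comp, Submodule.map_comp]
    rw [coe_orderIso_map_aeval hp hpm hμ hp' hpm' hμ' φ P N hN', ih P hP, pow_succ', map_mul, Module.End.mul_eq_comp,
      Submodule.map_comp]

/-- The adjoint: `φ(p(A)⁻¹M) = p′(A′)⁻¹φ(M)` (Brickman–Fillmore's closure map of Thm. 7 ∕ Lemma 5 (a)).
[cite: BrickmanFillmore1967, Lemma 5 (a) (p. 816), Thm. 7 (p. 818)] -/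
theorem coe_orderIso_comap_aeval (hp : Irreducible p) (hpm : p.Monic) (hμ : minpoly k A ∣ p ^ n)
    (hp' : Irreducible p') (hpm' : p'.Monic) (hμ' : minpoly k A' ∣ p' ^ n') (φ : A.invtSubmodule ≃o A'.invtSubmodule)
    (M N : A.invtSubmodule) (hN : (N : Submodule k V) = (M : Submodule k V).comap (aeval A p)) :
    (φ N : Submodule k W) = (φ M : Submodule k W).comap (aeval A' p') := by
  apply le_antisymm
  · rw [← Submodule.map_le_iff_le_comap]
    obtain ⟨P, hP⟩ : ∃ P : A.invtSubmodule, (P : Submodule k V) = (N : Submodule k V).map (aeval A p) :=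
      ⟨⟨_, map_aeval_mem_invtSubmodule A N.2 p⟩, rfl⟩
    rw [← coe_orderIso_map_aeval hp hpm hμ hp' hpm' hμ' φ N P hP]
    have hPM : P ≤ M := show (P : Submodule k V) ≤ M by rw [hP, Submodule.map_le_iff_le_comap, ← hN]
    exact φ.monotone hPM
  · obtain ⟨P', hP'⟩ : ∃ P' : A'.invtSubmodule, (P' : Submodule k W) = (φ M : Submodule k W).comap (aeval A' p') :=
      ⟨⟨_, comap_aeval_mem_invtSubmodule A' (φ M).2 p'⟩, rfl⟩
    obtain ⟨R', hR'⟩ : ∃ R' : A'.invtSubmodule, (R' : Submodule k W) = (P' : Submodule k W).map (aeval A' p') :=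
      ⟨⟨_, map_aeval_mem_invtSubmodule A' P'.2 p'⟩, rfl⟩
    have h1 := coe_orderIso_map_aeval hp' hpm' hμ' hp hpm hμ φ.symm P' R' hR'
    have hR'M : R' ≤ φ M := show (R' : Submodule k W) ≤ φ M by rw [hR', Submodule.map_le_iff_le_comap, ← hP']
    have h2 : ((φ.symm P' : A.invtSubmodule) : Submodule k V).map (aeval A p) ≤ M := by
      rw [← h1]
      have h3 := φ.symm.monotone hR'M
      rw [φ.symm_apply_apply] at h3
      exact h3
    have h4 : φ.symm P' ≤ N := show ((φ.symm P' : A.invtSubmodule) : Submodule k V) ≤ N by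
      rw [hN, ← Submodule.map_le_iff_le_comap]
      exact h2
    have h5 := φ.monotone h4
    rw [φ.apply_symm_apply] at h5
    rw [← hP']
    exact h5

/-- **`φ(Im p(A)ʲ) = Im p′(A′)ʲ`** (Longstaff (vi) for primary lattices; with §3, `φ` maps the whole lattice generated by the kernels and images of
the powers of `p(A)` onto that of `p′(A′)`). [cite: Longstaff1976, §3 Thm. 3.1 proof (vi)–(vii) (pp. 1064–1065)] [cite: BrickmanFillmore1967, Thm. 8 (p. 820)] -/
theorem coe_orderIso_range_aeval_pow (hp : Irreducible p) (hpm : p.Monic) (hμ : minpoly k A ∣ p ^ n)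
    (hp' : Irreducible p') (hpm' : p'.Monic) (hμ' : minpoly k A' ∣ p' ^ n') (φ : A.invtSubmodule ≃o A'.invtSubmodule) (j : ℕ)
    (N : A.invtSubmodule) (hN : (N : Submodule k V) = LinearMap.range (aeval A (p ^ j))) :
    (φ N : Submodule k W) = LinearMap.range (aeval A' (p' ^ j)) := by
  have hN' : (N : Submodule k V) =
      ((⟨⊤, Module.End.invtSubmodule.top_mem A⟩ : A.invtSubmodule) : Submodule k V).map (aeval A (p ^ j)) := by
    rw [hN, LinearMap.range_eq_map]
  rw [coe_orderIso_map_aeval_pow hp hpm hμ hp' hpm' hμ' φ j _ N hN', coe_orderIso_top φ, LinearMap.range_eq_map]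

/-- `φ(Ker p(A)ⁱ ∩ Im p(A)ʲ) = Ker p′(A′)ⁱ ∩ Im p′(A′)ʲ`. [cite: Longstaff1976, §3 Thm. 3.1 proof (vii) (p. 1065)] -/
theorem coe_orderIso_ker_inf_range_aeval_pow (hp : Irreducible p) (hpm : p.Monic) (hμ : minpoly k A ∣ p ^ n)
    (hp' : Irreducible p') (hpm' : p'.Monic) (hμ' : minpoly k A' ∣ p' ^ n') (φ : A.invtSubmodule ≃o A'.invtSubmodule) (i j : ℕ)
    (N : A.invtSubmodule)
    (hN : (N : Submodule k V) = LinearMap.ker (aeval A (p ^ i)) ⊓ LinearMap.range (aeval A (p ^ j))) :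
    (φ N : Submodule k W) = LinearMap.ker (aeval A' (p' ^ i)) ⊓ LinearMap.range (aeval A' (p' ^ j)) := by
  have hRmem : LinearMap.range (aeval A (p ^ j)) ∈ A.invtSubmodule := by
    rw [LinearMap.range_eq_map]
    exact map_aeval_mem_invtSubmodule A (Module.End.invtSubmodule.top_mem A) _
  obtain ⟨R, hR⟩ : ∃ R : A.invtSubmodule, (R : Submodule k V) = LinearMap.range (aeval A (p ^ j)) := ⟨⟨_, hRmem⟩, rfl⟩
  have hN' : N = (⟨LinearMap.ker (aeval A (p ^ i)), ker_aeval_mem_invtSubmodule A _⟩ : A.invtSubmodule) ⊓ R :=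
    Subtype.ext (by rw [Sublattice.coe_inf, hR]; exact hN)
  rw [hN', coe_orderIso_inf φ, coe_orderIso_ker_aeval_pow hp hpm hμ hp' hpm' hμ' φ i
    ⟨LinearMap.ker (aeval A (p ^ i)), ker_aeval_mem_invtSubmodule A _⟩ rfl, coe_orderIso_range_aeval_pow hp hpm hμ hp' hpm' hμ' φ j R hR]

/-! ## §7 Longstaff's step (i) and «`Hyperlat ⊇ Fix`-members» for primary lattices: the join-irreducible members are the non-zero cyclic
members; every automorphism of `L(A)` fixes `Ker p(A)ʲ`, `Im p(A)ʲ`, their meets and spans of meets, and `p(A)M`, `p(A)⁻¹M` along with `M` -/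

omit [FiniteDimensional k W] in
/-- **Longstaff (i) for a primary lattice: a member `M ∈ L(A)` (`A` `p`-primary) is join-irreducible iff `M ≠ {0}` and `M` is cyclic.**
`⟹`: with `M₀ < M` of dimension `dim M − d` and `x ∈ M ∖ M₀`, `M₀ ∨ Z(x; A) = M` (its dimension is a multiple of `d` strictly above
`dim M₀`); `⟸`: the members below `Z(x; A)` form a chain (Lemma 2). [cite: Longstaff1976, §3 Thm. 3.1 proof (i) (p. 1063)]
[cite: BrickmanFillmore1967, Lemma 2 (p. 812), Lemma 4 (b), (c) (p. 813)] -/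
theorem supIrred_iff_exists_cyclicSubspace_eq_of_minpoly_dvd_pow (hp : Irreducible p) (hpm : p.Monic) (hμ : minpoly k A ∣ p ^ n)
    (M : A.invtSubmodule) : SupIrred M ↔ (M : Submodule k V) ≠ ⊥ ∧ ∃ x : V, cyclicSubspace A x = M := by
  constructor
  · rintro ⟨hmin, hirr⟩
    have hM0 : (M : Submodule k V) ≠ ⊥ := fun h ↦ hmin (by
      rw [show M = ⊥ from Subtype.ext h]
      exact isMin_bot)
    refine ⟨hM0, ?_⟩
    obtain ⟨M₀, hM₀, hlt, hdim⟩ := exists_lt_finrank_add_natDegree_eq hp hpm hμ M.2 hM0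
    obtain ⟨x, hxM, hxM₀⟩ := SetLike.exists_of_lt hlt
    have hZM : cyclicSubspace A x ≤ (M : Submodule k V) := (cyclicSubspace_le_iff A x M.2).2 hxM
    have hsup : (⟨M₀, hM₀⟩ : A.invtSubmodule) ⊔ ⟨cyclicSubspace A x, cyclicSubspace_mem_invtSubmodule A x⟩ = M := by
      apply Subtype.ext
      rw [Sublattice.coe_sup]
      change M₀ ⊔ cyclicSubspace A x = (M : Submodule k V)
      refine Submodule.eq_of_le_of_finrank_le (sup_le hlt.le hZM) ?_
      have hlt' : M₀ < M₀ ⊔ cyclicSubspace A x := lt_of_le_of_ne le_sup_left fun h ↦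
        hxM₀ (h ▸ Submodule.mem_sup_right (self_mem_cyclicSubspace A x))
      have h1 := Submodule.finrank_lt_finrank_of_lt hlt'
      -- `dim (M₀ ∨ Z(x))` is a multiple of `d` strictly above `dim M₀ = dim M − d`
      obtain ⟨a, ha⟩ := natDegree_dvd_finrank_of_mem_invtSubmodule A hp hpm hμ hM₀
      obtain ⟨b, hb⟩ := natDegree_dvd_finrank_of_mem_invtSubmodule A hp hpm hμ
        (Module.End.invtSubmodule.sup_mem hM₀ (cyclicSubspace_mem_invtSubmodule A x))
      rw [ha, hb] at h1
      rw [← hdim, ha, hb, ← mul_add_one]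
      exact Nat.mul_le_mul_left _ (Nat.lt_of_mul_lt_mul_left h1)
    rcases hirr hsup with h | h
    · exact absurd (congrArg Subtype.val h) (ne_of_lt hlt)
    · exact ⟨x, congrArg Subtype.val h⟩
  · rintro ⟨hM0, x, hx⟩
    refine ⟨fun hmin ↦ hM0 (congrArg Subtype.val (le_bot_iff.1 (hmin bot_le))), fun b c hbc ↦ ?_⟩
    have hb : b ≤ M := hbc ▸ le_sup_left
    have hc : c ≤ M := hbc ▸ le_sup_right
    rcases le_total_of_le_cyclicSubspace_of_minpoly_dvd_pow hp hpm hμ x b.2 c.2 (hx ▸ hb) (hx ▸ hc) with hle | hle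
    · right
      rw [← hbc]
      exact (sup_eq_right.2 (show b ≤ c from hle)).symm
    · left
      rw [← hbc]
      exact (sup_eq_left.2 (show c ≤ b from hle)).symm

/-- `φ` maps every span `Σ_t Ker p(A)^{a_t} ∩ Im p(A)^{b_t}` to the corresponding span for `A′`.
[cite: Longstaff1976, §3 Thm. 3.1 proof (vii) (p. 1065)] -/
theorem coe_orderIso_iSup_ker_inf_range_aeval_pow (hp : Irreducible p) (hpm : p.Monic) (hμ : minpoly k A ∣ p ^ n)
    (hp' : Irreducible p') (hpm' : p'.Monic) (hμ' : minpoly k A' ∣ p' ^ n') (φ : A.invtSubmodule ≃o A'.invtSubmodule)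
    {ι : Type*} (a b : ι → ℕ) (N : A.invtSubmodule)
    (hN : (N : Submodule k V) = ⨆ t, LinearMap.ker (aeval A (p ^ a t)) ⊓ LinearMap.range (aeval A (p ^ b t))) :
    (φ N : Submodule k W) = ⨆ t, LinearMap.ker (aeval A' (p' ^ a t)) ⊓ LinearMap.range (aeval A' (p' ^ b t)) := by
  have hRmem : ∀ j : ℕ, LinearMap.range (aeval A (p ^ j)) ∈ A.invtSubmodule := fun j ↦ by
    rw [LinearMap.range_eq_map]
    exact map_aeval_mem_invtSubmodule A (Module.End.invtSubmodule.top_mem A) _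
  obtain ⟨F, hF⟩ : ∃ F : ι → A.invtSubmodule,
      ∀ t, (F t : Submodule k V) = LinearMap.ker (aeval A (p ^ a t)) ⊓ LinearMap.range (aeval A (p ^ b t)) :=
    ⟨fun t ↦ ⟨_, Module.End.invtSubmodule.inf_mem (ker_aeval_mem_invtSubmodule A _) (hRmem (b t))⟩, fun t ↦ rfl⟩
  have hN' : N = ⟨⨆ t, (F t : Submodule k V), iSup_mem_invtSubmodule A fun t ↦ (F t).2⟩ := Subtype.ext (by
    rw [hN]
    exact iSup_congr fun t ↦ (hF t).symm)
  rw [hN', coe_orderIso_iSup φ F]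
  exact iSup_congr fun t ↦ coe_orderIso_ker_inf_range_aeval_pow hp hpm hμ hp' hpm' hμ' φ (a t) (b t) (F t) (hF t)

/-- **Every automorphism of a primary lattice `L(A)` FIXES the spans `Σ_t Ker p(A)^{a_t} ∩ Im p(A)^{b_t}`** (in particular `Ker p(A)ʲ`,
`Im p(A)ʲ` and their meets). [cite: Longstaff1976, §3 Thm. 3.1 proof (v)–(vii) (pp. 1064–1065)] -/
theorem orderIso_apply_eq_of_eq_iSup_ker_inf_range_aeval_pow (hp : Irreducible p) (hpm : p.Monic) (hμ : minpoly k A ∣ p ^ n)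
    (ν : A.invtSubmodule ≃o A.invtSubmodule) {ι : Type*} (a b : ι → ℕ) (N : A.invtSubmodule)
    (hN : (N : Submodule k V) = ⨆ t, LinearMap.ker (aeval A (p ^ a t)) ⊓ LinearMap.range (aeval A (p ^ b t))) : ν N = N :=
  Subtype.ext ((coe_orderIso_iSup_ker_inf_range_aeval_pow hp hpm hμ hp hpm hμ ν a b N hN).trans hN.symm)

/-- … and fixes `p(A)M` and `p(A)⁻¹M` along with `M`. [cite: Longstaff1976, §3 Thm. 3.1 proof (v)–(vi) (p. 1064)]
[cite: BrickmanFillmore1967, Thm. 7 (p. 818), Lemma 5 (a) (p. 816)] -/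
theorem orderIso_apply_eq_of_eq_map_aeval (hp : Irreducible p) (hpm : p.Monic) (hμ : minpoly k A ∣ p ^ n)
    (ν : A.invtSubmodule ≃o A.invtSubmodule) {M N : A.invtSubmodule} (hM : ν M = M)
    (hN : (N : Submodule k V) = (M : Submodule k V).map (aeval A p)) : ν N = N :=
  Subtype.ext (by rw [coe_orderIso_map_aeval hp hpm hμ hp hpm hμ ν M N hN, hM, hN])

/-- Companion for `p(A)⁻¹M`. [cite: Longstaff1976, §3 Thm. 3.1 proof (v) (p. 1064)] [cite: BrickmanFillmore1967, Thm. 7 (p. 818)] -/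
theorem orderIso_apply_eq_of_eq_comap_aeval (hp : Irreducible p) (hpm : p.Monic) (hμ : minpoly k A ∣ p ^ n)
    (ν : A.invtSubmodule ≃o A.invtSubmodule) {M N : A.invtSubmodule} (hM : ν M = M)
    (hN : (N : Submodule k V) = (M : Submodule k V).comap (aeval A p)) : ν N = N :=
  Subtype.ext (by rw [coe_orderIso_comap_aeval hp hpm hμ hp hpm hμ ν M N hN, hM, hN])

omit [FiniteDimensional k W] in
/-- An automorphism of a primary lattice preserves dimension (`d = d′`). [cite: Longstaff1976, §3 Thm. 3.1 proof (iii) (p. 1063)] -/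
theorem finrank_coe_orderIso_self (hp : Irreducible p) (hpm : p.Monic) (hμ : minpoly k A ∣ p ^ n)
    (ν : A.invtSubmodule ≃o A.invtSubmodule) (M : A.invtSubmodule) :
    finrank k (ν M : Submodule k V) = finrank k (M : Submodule k V) :=
  finrank_coe_orderIso_of_natDegree_eq hp hpm hμ hp hpm hμ rfl ν M

/-! ## §8 Theorem 8's COROLLARY for `p`-primary transformations (same `p`): `L(A₁) ≅ L(A₂)` iff `A₁` and `A₂` are similar -/

omit [FiniteDimensional k V] [FiniteDimensional k W] in
/-- For `A` `p`-primary and `g` prime to `p`, `g(A)` is injective, so `Ker (pᵐg)(A) = Ker pᵐ(A)` (the nullity of `f(A)` depends only on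
the `p`-part of `f`). [cite: BrickmanFillmore1967, §3 item 1 proof (p. 814: «every polynomial in `A` has the form `r(A) + s(A)p(A)` … is
either invertible or nilpotent»)] -/
theorem ker_aeval_pow_mul_eq_of_not_dvd (hp : Irreducible p) (hμ : minpoly k A ∣ p ^ n) {g : k[X]} (hg : ¬p ∣ g) (m : ℕ) :
    LinearMap.ker (aeval A (p ^ m * g)) = LinearMap.ker (aeval A (p ^ m)) := by
  obtain ⟨a, b, hab⟩ := ((hp.coprime_iff_not_dvd.2 hg).pow_left : IsCoprime (p ^ n) g)
  have hpn : aeval A (p ^ n) = 0 := aeval_eq_zero_of_dvd_aeval_eq_zero hμ (minpoly.aeval k A)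
  have h1 : aeval A b * aeval A g = 1 := by
    have := congrArg (aeval A) hab
    rwa [map_add, map_mul, map_mul, hpn, mul_zero, zero_add, map_one] at this
  have hinj : LinearMap.ker (aeval A g) = ⊥ :=
    LinearMap.ker_eq_bot.2 (Function.LeftInverse.injective (g := aeval A b) fun x ↦ by
      rw [← Module.End.mul_apply, h1, Module.End.one_apply])
  rw [mul_comm, map_mul, Module.End.mul_eq_comp, LinearMap.ker_comp, hinj, Submodule.comap_bot]

/-- **A lattice isomorphism between the lattices of two `p`-primary transformations (the same `p`) preserves the nullity of every
polynomial: `dim Ker f(A₁) = dim Ker f(A₂)`** (`f = pᵐg`, `p ∤ g`: both are `dim Ker pᵐ`, matched by §3 and §2).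
[cite: BrickmanFillmore1967, Thm. 8 and Corollary (p. 820)] [cite: Longstaff1976, §3 Thm. 3.1 proof (iii), (v) (pp. 1063–1064)] -/
theorem finrank_ker_aeval_eq_of_orderIso (hp : Irreducible p) (hpm : p.Monic) (hμ : minpoly k A ∣ p ^ n) (hμ' : minpoly k A' ∣ p ^ n')
    (φ : A.invtSubmodule ≃o A'.invtSubmodule) (f : k[X]) :
    finrank k ↥(LinearMap.ker (aeval A f)) = finrank k ↥(LinearMap.ker (aeval A' f)) := by
  by_cases hf : f = 0
  · rw [hf, map_zero, LinearMap.ker_zero, finrank_top, map_zero, LinearMap.ker_zero, finrank_top]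
    have h := natDegree_mul_finrank_eq_of_orderIso hp hpm hμ hp hpm hμ' φ
    exact (Nat.eq_of_mul_eq_mul_left (Polynomial.natDegree_pos_iff_degree_pos.2 (degree_pos_of_irreducible hp)) h).symm
  obtain ⟨m, g, hg, rfl⟩ := WfDvdMonoid.max_power_factor' hf hp.not_isUnit
  rw [ker_aeval_pow_mul_eq_of_not_dvd hp hμ hg m, ker_aeval_pow_mul_eq_of_not_dvd hp hμ' hg m,
    ← coe_orderIso_ker_aeval_pow hp hpm hμ hp hpm hμ' φ m ⟨LinearMap.ker (aeval A (p ^ m)), ker_aeval_mem_invtSubmodule A _⟩ rfl,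
    finrank_coe_orderIso_of_natDegree_eq hp hpm hμ hp hpm hμ' rfl φ]

/-- Hence `A₁` and `A₂` have the same invariant factors (Jacobson's count: the nullities `dim Ker f(A)` determine the invariant factors).
[cite: BrickmanFillmore1967, Thm. 8 Corollary (p. 820)] -/
theorem invariantFactors_eq_of_orderIso (hp : Irreducible p) (hpm : p.Monic) (hμ : minpoly k A ∣ p ^ n) (hμ' : minpoly k A' ∣ p ^ n')
    (φ : A.invtSubmodule ≃o A'.invtSubmodule) : invariantFactors A = invariantFactors A' :=
  invariantFactors_eq_of_forall_finrank_ker_aeval_eq A A' (finrank_ker_aeval_eq_of_orderIso hp hpm hμ hμ' φ)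

/-- **Theorem 8, converse, for `p`-primary transformations with the same `p` (`σ = id`): a lattice isomorphism `L(A₁) ≅ L(A₂)` comes with an
intertwining linear isomorphism `T : V ≃ W`, `TA₁ = A₂T`.** [cite: BrickmanFillmore1967, Thm. 8 (p. 820)] -/
theorem exists_linearEquiv_of_orderIso_of_minpoly_dvd_pow (hp : Irreducible p) (hpm : p.Monic) (hμ : minpoly k A ∣ p ^ n)
    (hμ' : minpoly k A' ∣ p ^ n') (φ : A.invtSubmodule ≃o A'.invtSubmodule) :
    ∃ T : V ≃ₗ[k] W, T.toLinearMap ∘ₗ A = A' ∘ₗ T.toLinearMap :=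
  exists_linearEquiv_of_invariantFactors_eq A A' (invariantFactors_eq_of_orderIso hp hpm hμ hμ' φ)

/-- **`L(A₁) ≅ L(A₂)` iff `A₁`, `A₂` are similar, for `p`-primary `A₁` on `V` and `A₂` on `W` (same `p`).**
[cite: BrickmanFillmore1967, Thm. 8 and Corollary (p. 820)] -/
theorem nonempty_orderIso_iff_exists_linearEquiv_of_minpoly_dvd_pow (hp : Irreducible p) (hpm : p.Monic)
    (hμ : minpoly k A ∣ p ^ n) (hμ' : minpoly k A' ∣ p ^ n') :
    Nonempty (A.invtSubmodule ≃o A'.invtSubmodule) ↔ ∃ T : V ≃ₗ[k] W, T.toLinearMap ∘ₗ A = A' ∘ₗ T.toLinearMap := by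
  refine ⟨fun ⟨φ⟩ ↦ exists_linearEquiv_of_orderIso_of_minpoly_dvd_pow hp hpm hμ hμ' φ, fun ⟨T, hT⟩ ↦ ?_⟩
  obtain ⟨φ, -⟩ := exists_orderIso_coe_eq_map T hT
  exact ⟨φ⟩

/-- **Brickman–Fillmore, Theorem 8 COROLLARY, verbatim setting: «Let `A₁` and `A₂` be `p`-primary linear transformations on the vector
space `V`. Then `L(A₁) ≅ L(A₂)` if and only if `A₁` and `A₂` are similar.»** [cite: BrickmanFillmore1967, Thm. 8 Corollary (p. 820)] -/
theorem nonempty_orderIso_iff_exists_conj_of_minpoly_dvd_pow {A₁ A₂ : Module.End k V} (hp : Irreducible p) (hpm : p.Monic)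
    (h₁ : minpoly k A₁ ∣ p ^ n) (h₂ : minpoly k A₂ ∣ p ^ n') :
    Nonempty (A₁.invtSubmodule ≃o A₂.invtSubmodule) ↔ ∃ T : V ≃ₗ[k] V, A₂ = T.conj A₁ := by
  rw [nonempty_orderIso_iff_exists_linearEquiv_of_minpoly_dvd_pow hp hpm h₁ h₂]
  refine exists_congr fun T ↦ ?_
  rw [LinearEquiv.conj_apply]
  constructor
  · intro hT
    rw [hT, LinearMap.comp_assoc, ← LinearEquiv.coe_trans, LinearEquiv.symm_trans_self, LinearEquiv.refl_toLinearMap,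
      LinearMap.comp_id]
  · intro hT
    rw [hT, LinearMap.comp_assoc, ← LinearEquiv.coe_trans, LinearEquiv.self_trans_symm, LinearEquiv.refl_toLinearMap,
      LinearMap.comp_id]

end Literature.LinearAlgebra
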